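import Summits.HodgeConjecture.HodgeConjecture.Theorems.HCCMUnconditionalHLiu418OfFacts
import HarnessLib

/-!
# The hLiu418 closing head with row III-0 replaced by its CONSEQUENCE at the pin (the Betti pinning `StubPinBettiPinning`)
# — consumer re-plumb (γ) of the (G)-road of [Liu 2021, Lem. 2.4 (1)]

Cell `hodgecm-mathlib`, fan A, crux `HLiu418` (stmt-HodgeConjecture-24832), skeleton `Cruxes/HLiu418/Lines/a3_liu418.lean`; (G)-road of record
(director BATCH 59, lead A-p18, carve `A-provers/A-p18/CARVE-G-road.md` §«Consumer re-plumb»; A-plan2 census 2026-08-28T07:30:48Z (α)(β)(γ)).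
THEOREMS ONLY; every closed slot BY NAME.

A-p18's head `HypLiu418.HLiu418_of_facts (hL) (hFal) (h415) (hε) h21 h413 hD3` (`HCCMUnconditionalHLiu418OfFacts`) consumes the named fact
`hL : Liu2021.albanese_bettiOne_pullback_bijective` (row III-0, [Liu2021] Lem. 2.4 (1) AS TYPED — for all smooth `X`) ONLY through the Betti
pinning at the pin, `pinBettiPinning_of_lemma24 hL : StubPinBettiPinning` (A-p18 p603007), at place via
`bettiThetaModelAtPlace_of_hyp413_of_pinning` (A-p06 g0 p600917) and off place via A-p02's END.  The (G)-road proves Lem. 2.4 (1) only for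
PROJECTIVE `X` (F6, `albanese_bettiOne_pullback_bijective_of_isProjectiveOver`), which is all the pin needs; so the head is RE-PLUMBED to take the
pinning itself: `HLiu418_of_facts_of_pinning (hpin : StubPinBettiPinning) (hFal) (h415) (hε) h21 h413 hD3 : HLiu418`, the off-place branch through
A-p02's twin `stubBettiThetaModelOffPlace_of_h413_of_unique_of_pinning` ((β)).  When A-p18's (α) `pinBettiPinning_of_jacobianDim` lands
(hypothesis-free after F5 ★ p612173 / G4 / F6), `HLiu418_of_facts_of_jacobianDim := HLiu418_of_facts_of_pinning pinBettiPinning_…` and row III-0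
LEAVES the residual list of hLiu418 (⇐ {VI-1, III-9′, III-11} + items).  HC_CM is proved only modulo the 7 printed citations until rung 0 closes.

References: [Liu2021] Lem. 2.4 (1) (FJcycle.tex l. 1210–1228), §4.2 l. 2074–2081, Prop. 4.13, Thm. 4.18; [Deligne1971TravauxShimura] 5.5.
-/

noncomputable section

namespace Summit.HodgeConjecture.CorCM.HypLiu418

open scoped TensorProduct Matrix
open NumberField NumberField.InfinitePlace
open HodgeCM.Model HodgeCM.Model.LiuIndex HodgeCM.Model.TowerCarrier
open Summit.HodgeConjecture.CorCM.Model
open Literature.AlgebraicGeometry.Motives (CMType AbelianVariety)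
open Literature.AlgebraicGeometry.HodgeTheory Literature.NumberTheory.Automorphic.PicardCM
open Literature.AlgebraicGeometry.ShimuraVarieties.UnitaryCanonicalModel
open Literature.NumberTheory.ComplexMultiplication
open Literature.NumberTheory.Automorphic
open Literature.NumberTheory.Automorphic.Liu2021 Literature.NumberTheory.Automorphic.Liu2021.AppendixC
open Literature.NumberTheory.Automorphic.Liu2021.AppendixC.RestOne
open Literature.RepresentationTheory Literature.RepresentationTheory.Liu2021
open Summit.HodgeConjecture.CorCM.Transposition
open Summit.HodgeConjecture.CorCM.D2Bridge.MuKeyIdentLemD3DelRecConjOmegaEndT.PrintedCitationHypotheses (HypLiu418 Hyp411 Hyp413 HypD3 HypD1pp)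
open Summit.HodgeConjecture.CorCM.Lines.A3Liu418

set_option synthInstance.maxHeartbeats 400000 in
set_option maxHeartbeats 8000000 in
/-- **P from `H413` and the PINNING** (row III-0 enters only through `hpin : StubPinBettiPinning`; row I-4 by A-p07's theorem
`canonicalModel_unique_printed_holds`): the pinned Betti theta model at EVERY face — at place by `bettiThetaModelAtPlace_of_hyp413_of_pinning h413 hpin`,
off place by A-p02's twin `stubBettiThetaModelOffPlace_of_h413_of_unique_of_pinning h413 canonicalModel_unique_printed_holds hpin`, glued by the crux's
case split on `(mk ι₁).embedding = ι₁`.  (= A-p18's `bettiThetaModel_of_facts` with `pinBettiPinning_of_lemma24 hL` replaced by `hpin`.)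
[cite: Liu2021, Prop. 4.13 (FJcycle.tex l. 2110–2131); §4.2 l. 2074–2081; Lem. 2.4] [cite: Deligne1971TravauxShimura, 5.5] -/
theorem bettiThetaModel_of_h413_of_pinning (h413 : Summit.HodgeConjecture.HodgeConjecture.Theses.HCCMUnconditional.H413)
    (hpin : StubPinBettiPinning) : StubBettiThetaModel := by
  intro hDel F _ h6 ι₁ V a Φ hΦ
  by_cases hemb : (NumberField.InfinitePlace.mk ι₁).embedding = ι₁
  · exact bettiThetaModelAtPlace_of_hyp413_of_pinning h413 hpin hDel F h6 V hemb a Φ hΦ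
  · exact stubBettiThetaModelOffPlace_of_h413_of_unique_of_pinning h413 canonicalModel_unique_printed_holds hpin hDel F h6 V hemb a Φ hΦ

set_option synthInstance.maxHeartbeats 400000 in
set_option maxHeartbeats 8000000 in
/-- **CLOSING-FILE HEAD of item stmt-HodgeConjecture-24832 with row III-0 replaced by the pinning** (consumer re-plumb (γ) of the (G)-road):
`HLiu418` from `hpin : StubPinBettiPinning` (the only use the line makes of [Liu2021] Lem. 2.4 (1)), the fact-level residuals `hFal` (row VI-1,
[Fal83]), `h415` (row III-9′), `hε` (row III-11), and the route items `H21`, `H413`, `HD3`; rows I-4 and VI-2″ enter as theorems.  The proof is A-p18's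
`HLiu418_of_facts` token for token with `bettiThetaModel_of_facts h413 hL` ↦ `bettiThetaModel_of_h413_of_pinning h413 hpin`.  With A-p18's
hypothesis-free pinning ((α), after F5/G4/F6) this gives the III-0-free head.  HC_CM is proved only modulo the 7 printed citations until rung 0
closes. [cite: Liu2021, Thm. 4.18 (FJcycle.tex l. 2235–2290); Lem. 2.4 (1)] -/
theorem HLiu418_of_facts_of_pinning (hpin : StubPinBettiPinning)
    (hFal : ∀ {K : Type} [Field K] (A B : AbelianVariety K) (ℓ : ℕ) [Fact ℓ.Prime], Literature.AlgebraicGeometry.Motives.faltings_tate_bijective A B ℓ)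
    (h415 : Thm415AtFace) (hε : EpsRigidAtFace)
    (h21 : Summit.HodgeConjecture.HodgeConjecture.Theses.HCCMUnconditional.H21) (h413 : Summit.HodgeConjecture.HodgeConjecture.Theses.HCCMUnconditional.H413)
    (hD3 : Summit.HodgeConjecture.HodgeConjecture.Theses.HCCMUnconditional.HD3) :
    Summit.HodgeConjecture.HodgeConjecture.Theses.HCCMUnconditional.HLiu418 := by
  intro hDel F _ h6 ι₁ V a Φ hΦ ν hν hw R' hR' Φ'
  have hP : StubBettiThetaModel := bettiThetaModel_of_h413_of_pinning h413 hpin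
  have s2 : StubNonIso := nonIso_of_hD3 hD3
  exact thm418AsPrinted_of_items _
    (mainGalois_of_facts (etaleBettiModel_of_facts hP) (faltingsIsotypic_of_faltings hFal) (galoisLabelSeparation_of_h21_of_thm415 h21 h415)
      (mainGaloisGlue_of_h21_of_epsRigid h21 hε) h415 Summit.HodgeConjecture.HodgeConjecture.Theorems.H411_proof s2 hDel F h6 V a Φ hΦ ν hν hw Φ' ⟨R', hR'⟩)
    (levelInvariants_holds hDel F h6 V a Φ hΦ ν hν hw Φ') (s2 hDel F h6 V a Φ hΦ ν hν hw Φ')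

end Summit.HodgeConjecture.CorCM.HypLiu418

end
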